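import Literature.MathematicalPhysics.QuantumFieldTheory.Balaban1983to89.Node00.Record12
import Literature.MathematicalPhysics.QuantumFieldTheory.Balaban1983to89.Node00.Record9InhabitedSU1
import Literature.MathematicalPhysics.QuantumFieldTheory.Balaban1983to89.Node00.ChartOfRecord
import Literature.MathematicalPhysics.QuantumFieldTheory.Balaban1983to89.B10Eq29TubeLine

/-!
# NODE 00 (YM-PLAN Track A) — STAGE 12, THE NUMERICS OF RECORD AND THE PARAMETER `θ₀` OF RECORD: `Stage12Numerics` (every numeric
# letter Stage-12 admissibility reads), its sign window `Pos`, the displayed defaults `stage12NumericsOfRecord`, the EXPLICIT non-numeric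
# part (Stage-1∕3 dictionary, degenerate Stage-5 residual, def-R's trivial representation, the chart of record of 𝔰𝔲(N), `c = 1`), the maker
# `stage12OfNumerics n res ζ Rz Zt` with `Admissible ↔ n.Pos`, and `theta12OfRecord ζ Rz Zt` — admissible UNCONDITIONALLY in the residual
# objects `ζ`, `Rz`, `Zt` it takes as arguments

Cell `pub-ymgap`, seat `pub-ymgap-node00-def-K0a` (director-ym R176; K0′ COMPONENTS bundle G1 = rows D1 ∕ A1 ∕ A2 ∕ A3 ∕ P10 of dag-lead's
NODE-TABLE v24 § K0′).  [I] = [Balaban1987RG1], [III] = [Balaban1988Convergent], [IV] = [Balaban1989LargeFieldI].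

WHY.  The rev-8 crux K0′ `Record12Inhabited := ∃ D w, Node00.IsRecordOfRecord₁₂C F 2 D w` unfolds, by def-T's `exists_world_isRecordOfRecord₁₂C θ h hθ hγw`
(`Node00/Record12`, v2.1), to «SOME `θ : Stage12Params F 2` with `θ.Admissible F 2` and `θ.Provisos₁₂ F 2`».  `Admissible` reads NUMERIC letters only
(Stage-1 windows, `0 < γ < 1`, def-R's Stage-7 windows, `0 < εbg`, `0 < cβ` + the chart clause of record, `1 ≤ τ9.M`, the §2 signs `s2.Pos`, `Pos₁₂`);
`Provisos₁₂` reads the RESIDUAL objects (`base`, `rzLaws`, `ztLaws`, `ztLocal`, the window-guarded `bg`).  This file settles the NUMERIC half once, for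
every family `F` and every `N ≥ 1`, and fixes THE parameter of record `θ₀` at which the residual rows (seats K0b ∕ K0c ∕ K0e ∕ def-R ∕ the `bg` owner)
state their fields — with the three residual objects `ζ` (Stage 9, (3.16) [III]), `Rz` (11b's §2 data), `Zt` (12a's residual 𝐓-weight part) as
ARGUMENTS, so that K0b's residuals of record plug in by name and nothing here pre-empts them.

* §1 `Stage12Numerics` = (def-R's `Stage7Numerics` `ν`, the background radius `εbg` (I.0.21), the coupling window `γ`, def-R's `TowerNumerics` `τ9`,
  `A₁` of (I.1.16)∕(3.4), the §2 numerics `s2 : Sect2Numerics` incl. the term constants `lf : Step.LFConsts` and `cR`); `Stage12Numerics.Pos` = exactly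
  the sign windows Stage-12 admissibility reads off them; the DISPLAYED DEFAULTS `numerics7OfRecord₁₂`, `lfConstsOfRecord₁₂`, `sect2NumericsOfRecord₁₂`,
  `towerNumericsOfRecord₁₂`, `stage12NumericsOfRecord` (all windows met with the simplest numerals: every «sufficiently large» constant `1`, `β := 1∕4`
  («e.g., we can take β = 1∕4», p. 261 [III]), `q₀ = q₁ := 2` («integers greater than 1», (2.28)), `γ := 1∕2`, `M := 1`) and `stage12NumericsOfRecord_pos`.
* §2 the EXPLICIT non-numeric part: `stage3OfRecord₁₂` (the `Stage1Params.exists_admissible` ∕ `N24_exists_stage3Params` witness values AS A DEFINITION: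
  two colours, the rotation flow, `D = 4`, `L = 3`, `𝔸 := Matrix (Fin 2) (Fin 2) ℂ` (= `M_{N₅}(ℂ)`, `N₅ = 2`; `ℂ` before the RE-KEY EDITION below), `d₆ = 3`, `ℓ₆ = 2`,
  unit weight band, `δ₀ = 2∕3`), `residual5OfRecord₁₂` (the DEGENERATE
  Stage-5 residual of `Record8Inhabited`: carriers from the `Node00.Satisfiable` instances, zero β ∕ `E` ∕ actions, `R := id` — NOT objects of record;
  every Stage-7…12 pin overwrites what it reads); the β-chart is n23-b's CHART OF RECORD of 𝔰𝔲(N) with `c = 1`, BY NAME (`Node00/ChartOfRecord`: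
  `suChartDim`, `suChartMap`, `isSuChart_suChartMap` — the maker's Stage-8 part has the shape of `Stage8Params.rechart`).
* §3 the MAKER: `stage8OfNumerics n res` (Stage 8: the dictionary above, `γ`, `ν`, `εbg` from `n`, def-R's `trivialRepOfRecord`, `Efl = logz = 0`,
  the chart of record, `v₀ := 0`) and `stage12OfNumerics n res ζ Rz Zt` (Stage 9: `τ9 := n.τ9`, the IDENTITY `p–p′` selector `ppSelIdOfRecord`, `A₁ := n.A₁`,
  `ζ := ζ`, `ScorrLaw := ⊤` — unread at Stage 12, where `ScorrLawOfRecord₁₂` is the pin —, `cβ := 1`; Stage 12: `s2 := n.s2`, `Rz`, `Zt`), their `rfl`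
  views, `isChartOfRecord_stage8OfNumerics`, **`admissible_stage8OfNumerics_iff`**, **`admissible_stage12OfNumerics_iff : … ↔ n.Pos`** — residual-blind.
* §4 `θ₀`: `stage8OfRecord₁₂ F N` and **`theta12OfRecord F N ζ Rz Zt`** (the maker at the defaults), **`admissible_theta12OfRecord`** (rows D1+A1+A2+A3,
  hypothesis-free), the faces `admissible9_theta12OfRecord` (A1), `s2Pos_theta12OfRecord` (A2), `pos12_theta12OfRecord` (A3), `alphaPos_theta12OfRecord` ∕
  `alphaPos_theta12OfRecord_of_inInterval` (P10 = def-T's `alphaPos₁₂_of_window` ∕ `_of_inInterval` AT `θ₀`: the radii (2.28) are positive in the window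
  `0 < g ≤ 1∕2`), the bridge `theta12OfRecord_toStage9Params_delta` (at K0b-independent `ζ := zetaDeltaOfRecord` the Stage-9 part IS
  `{stage9DeltaOfRecord (stage8OfRecord₁₂) with A₁ := 1}`, def-T's recommended carrier, so n23-b's `Record9∕10ProvisosOfRegularity` reductions re-key),
  and `exists_admissible_stage12Params` (ADMISSIBLE Stage-12 parameters with 12a's residual laws `ztLaws`, `ztLocal` exist — every `F`, every `N ≥ 1`, any
  `Rz`; def-T's PROBE-K0′ shape, landed once here).

EDITION — RECORD-NONABELIAN RE-KEY (director-ym №256 (2) ∕ FLAG №14 «RECORD-ABELIAN»; plan g91 SIZING WORD road α; pen `pub-ymgap-node00-def-RR-2` g20).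
The coefficient C⋆-algebra of the dictionary of record is RE-KEYED from `ℂ` (an abelian instance, G = U(1)) to print's matrix algebra at the record's own
colour number `N₅ = 2`: `stage3OfRecord₁₂.𝔸 := Matrix (Fin 2) (Fin 2) ℂ` ([Balaban1985RegularSpaces] p.77 «gauge field configurations with values in
G ⊂ M_N(ℂ)»; [I] (0.1) p.251), with the C⋆-structure `B10Eq29TubeLine.cstarAlgebraMatrix 2` (Mathlib's L²-operator-norm structure, the cell's standing
device) in the carried field `instCStar` and `instNontrivial` from Mathlib.  EVERY OTHER FIELD, STATEMENT AND PROOF OF THIS FILE IS VERBATIM: Stage-1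
admissibility reads no 𝔸 (`admissible_stage3OfRecord₁₂` is the same 13 numeral clauses), the Stage-8∕12 makers and every later pin are `{ … with }` over
this dictionary and INHERIT the field (`Record12NumericsFamilyDict.stage3OfFamily F` included).  Commutativity of `𝔸` is NOT available at the record
(№256 (3)); general `N` lives in the family dictionary `stage3OfFamilyMat F N` of `Theorems/BalabanUVNodesN16Stage3OfFamilyMat`, not here.

## HONEST FRAMING — what this is NOT

* A bookkeeping WITNESS of the NUMERIC half of K0′ and kernel `rfl` plumbing.  The numerals are DISPLAYED DEFAULTS meeting the sign windows — NOT
  Bałaban's (undetermined) «sufficiently large ∕ small» constants of [I] Thm 1, [III] (2.4)∕(2.28)∕(2.31)∕(2.42), [IV] (2.1); a row whose estimate needs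
  other values (the window-guarded `bg`: `C₀, C₁, q₀, q₁` against `A₀, p₀, cR`, a smaller `γ`) re-instantiates `stage12OfNumerics` at its own
  `n : Stage12Numerics` — the theorems of §3 are generic in `n`.  NOTHING of Bałaban's is asserted; `Provisos₁₂` is NOT touched (rows P1–P9, P11 are other
  seats'); K0′ is NOT discharged here; no node count moves.
* The non-numeric part is DEGENERATE where the record does not read it (Stage-5 carriers `X, Y, Z, W`, the superseded `rep`, `Efl`, `logz`, `v₀`) and
  CHOSEN where print has an object the tree only proves to exist (the `hsForm`-orthonormal chart of 𝔰𝔲(N): n23-b's `suChartMap`, a `Classical.choose`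
  from `Record8Chart.exists_isSuChart_one`); at
  `N = 2` print's own Pauli chart (`Record8Chart.pauliChart`, `c = 2`) is the displayed alternative — not used here so that one definition serves every `N`.
* One finite four-torus programme at fixed `ε` — NOT the continuum limit on ℝ⁴, NOT infinite volume, NOT OS, NOT a mass gap, NOT the Clay problem.
-/

noncomputable section

open MeasureTheory
open scoped Matrix.Norms.L2Operator

namespace Literature.MathematicalPhysics.QuantumFieldTheory.Balaban1983to89.Node00

open T4Continuum AveragingRT T4FiniteEpsInhabited FlowStep FlowStepRuns DagBinding T4DatumAssembly B4GaugeCovariance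

/-! ## §1. The numerics of the Stage-12 record -/

/-- **THE NUMERIC LETTERS STAGE-12 ADMISSIBILITY READS**, bundled: def-R's Stage-7 dictionary `ν = (M₁, M₂, r, p₀, A₀, log σ₀, εreg, ε₀)` ((2.4)–(2.5),
(2.12)–(2.13), (2.17) [III]), the background regularity radius `εbg` ((0.21) [I]), the small-coupling window `γ` ([I] Thm 1), def-R's tower numerics
`τ9 = (M, Nsz, Nmem)` ((2.1) [IV]), the constant `A₁` of (I.1.16)∕(3.4), and the §2 numerics `s2` (incl. the term constants (2.28)∕(2.31)∕(2.42) and the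
located regularity constant `cR` of p. 256). [cite: Balaban1988Convergent, (2.4)–(2.5) p.255, (2.10) p.256, (2.28) p.259, (3.4) p.265; Balaban1987RG1, (0.21) p.256, (1.12)–(1.16) p.262 (parameter dictionary)] -/
structure Stage12Numerics where
  /-- def-R's Stage-7 numeric dictionary -/
  ν : Stage7Numerics
  /-- the background regularity radius `ε` of (I.0.21) -/
  εbg : ℝ
  /-- the small-coupling window constant `γ` -/
  γ : ℝ
  /-- def-R's tower numerics `(M, Nsz, Nmem)` -/
  τ9 : TowerNumerics
  /-- the constant `A₁` of (I.1.16) ∕ (3.4) -/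
  A₁ : ℝ
  /-- the §2 numerics -/
  s2 : Sect2Numerics

/-- **THE SIGN WINDOWS** Stage-12 admissibility reads off the numerics: def-R's Stage-7 windows (`0 < ε₀`, `0 < εreg`, `0 < A₀`, `1 ≤ M₁`, `1 ≤ M₂`),
`0 < εbg`, the coupling window `0 < γ < 1`, genuine cubes `1 ≤ M`, `0 < A₁`, the §2 signs `s2.Pos`, and `0 < cR`, `0 < C₀`, `0 < C₁`.
[cite: Balaban1988Convergent, (2.4) p.255, (2.10) p.256, (2.28) p.259, (2.34)–(2.39) p.261, (3.4) p.265; Balaban1987RG1, (0.21) p.256 (hypothesis dictionary)] -/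
def Stage12Numerics.Pos (n : Stage12Numerics) : Prop :=
  (0 < n.ν.ε₀ ∧ 0 < n.ν.εreg ∧ 0 < n.ν.A₀ ∧ 1 ≤ n.ν.M₁ ∧ 1 ≤ n.ν.M₂) ∧ 0 < n.εbg ∧ (0 < n.γ ∧ n.γ < 1) ∧ 1 ≤ n.τ9.M ∧ 0 < n.A₁ ∧
    n.s2.Pos ∧ 0 < n.s2.cR ∧ 0 < n.s2.lf.C₀ ∧ 0 < n.s2.lf.C₁

/-- **def-R's Stage-7 numerics, displayed defaults**: `M₁ = M₂ := 1`, `r := 1`, `p₀ := 1`, `A₀ := 1`, `log σ₀ := 0`, `εreg := 1`, `ε₀ := 1` (every window met;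
NOT print's undetermined constants). [cite: Balaban1988Convergent, (2.4)–(2.5) p.255, (2.13) p.256, (2.17) p.257 (bookkeeping witness)] -/
def numerics7OfRecord₁₂ : Stage7Numerics where
  M₁ := 1
  M₂ := 1
  r := 1
  p₀ := 1
  A₀ := 1
  logσ₀ := 0
  εreg := 1
  ε₀ := 1

/-- **The term constants (2.28)∕(2.31)∕(2.42), displayed defaults**: `A₀ := 1`, `p₀ := 1` (the same letters as `numerics7OfRecord₁₂`), `C₀ = C₁ := 1`,
`q₀ = q₁ := 2` («integers greater than 1»), `κ := 1`, `κ₀ := 1`, `E₀ := 1`, `B₀ := 1`, `γ := 1∕2`. [cite: Balaban1988Convergent, (2.4) p.255, (2.28) p.259, (2.31) p.260, (2.42) p.261 (bookkeeping witness)] -/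
def lfConstsOfRecord₁₂ : Step.LFConsts where
  A₀ := 1
  p₀ := 1
  C₀ := 1
  q₀ := 2
  C₁ := 1
  q₁ := 2
  κ := 1
  κ₀ := 1
  E₀ := 1
  B₀ := 1
  γ := 1 / 2

/-- **The §2 numerics, displayed defaults**: `O(1)LMB := 1`, `β := 1∕4` («e.g., we can take β = 1∕4», p. 261), `B = C = M := 1`, `cR := 1`, the term
constants `lfConstsOfRecord₁₂`. [cite: Balaban1987RG1, (1.12) p.262; Balaban1988Convergent, (2.10) p.256, (2.34)–(2.39) p.261 (bookkeeping witness)] -/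
def sect2NumericsOfRecord₁₂ : Sect2Numerics where
  cB := 1
  βc := 1 / 4
  B := 1
  C := 1
  Mr := 1
  cR := 1
  lf := lfConstsOfRecord₁₂

/-- **def-R's tower numerics, displayed defaults**: `M := 1` (genuine `M R_j`-cubes), `Nsz := 0`, `Nmem := 0` (the values of n23-b's
`Record9InhabitedSU1.stage9DeltaOfRecord`, so that the existing Stage-9∕10 reductions re-key). [cite: Balaban1989LargeFieldI, (2.1) p.182 and p.177 (conditions (i), (ii)) (bookkeeping witness)] -/
def towerNumericsOfRecord₁₂ : TowerNumerics where
  M := 1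
  Nsz := 0
  Nmem := 0

/-- **THE NUMERICS OF RECORD of the Stage-12 parameter `θ₀`**: `ν := numerics7OfRecord₁₂`, `εbg := 1`, `γ := 1∕2`, `τ9 := towerNumericsOfRecord₁₂`, `A₁ := 1`,
`s2 := sect2NumericsOfRecord₁₂`. [cite: Balaban1988Convergent, (2.4) p.255, (2.10) p.256, (2.28) p.259, (3.4) p.265; Balaban1987RG1, (0.21) p.256 (bookkeeping witness)] -/
def stage12NumericsOfRecord : Stage12Numerics where
  ν := numerics7OfRecord₁₂
  εbg := 1
  γ := 1 / 2
  τ9 := towerNumericsOfRecord₁₂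
  A₁ := 1
  s2 := sect2NumericsOfRecord₁₂

/-- The §2 defaults meet the §2 sign conditions `Sect2Numerics.Pos` (`0 < 1`, `0 ≤ 1∕4 < 1`, `0 < 1·1·1`). [cite: Balaban1988Convergent, (2.34)–(2.39) p.261 (bookkeeping)] -/
theorem sect2NumericsOfRecord₁₂_pos : sect2NumericsOfRecord₁₂.Pos := by
  refine ⟨one_pos, ?_, ?_, ?_⟩ <;> norm_num [sect2NumericsOfRecord₁₂]

/-- **The numerics of record meet every sign window** (`stage12NumericsOfRecord.Pos`). [cite: Balaban1988Convergent, (2.4) p.255, (2.10) p.256, (2.28) p.259, (2.34)–(2.39) p.261; Balaban1987RG1, (0.21) p.256 (bookkeeping)] -/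
theorem stage12NumericsOfRecord_pos : stage12NumericsOfRecord.Pos := by
  refine ⟨⟨?_, ?_, ?_, ?_, ?_⟩, ?_, ⟨?_, ?_⟩, ?_, ?_, sect2NumericsOfRecord₁₂_pos, ?_, ?_, ?_⟩ <;>
    norm_num [stage12NumericsOfRecord, numerics7OfRecord₁₂, towerNumericsOfRecord₁₂, sect2NumericsOfRecord₁₂, lfConstsOfRecord₁₂]

/-! ## §2. The explicit non-numeric part of the record -/

/-- **The Stage-1∕2∕3 dictionary of record AS A DEFINITION** (the values of `Stage1Params.exists_admissible` and `N24Glue.N24_exists_stage3Params`): two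
colour components with the rotation flow of [Balaban1983RegularityDecay] (1.2) (Lipschitz modulus `1`, `B4Lower18Regular.rot_lipschitz`), `D = 4`, `L = 3`,
unit windows and constants, coefficient C⋆-algebra `𝔸 := Matrix (Fin 2) (Fin 2) ℂ` (`M_{N₅}(ℂ)` at `N₅ = 2`, structure `B10Eq29TubeLine.cstarAlgebraMatrix 2`;
RE-KEYED from `ℂ`, director-ym №256 (2)), `d₆ = 3`, `ℓ₆ = 2`, weight band `b₀ = b₁ = 1`, Lemma-2.1 rate `δ₀ = 2∕3`.
[cite: Balaban1983RegularityDecay, (1.2) p.572; Balaban1984PropagatorsII, (2.1)–(2.4) p.224, (2.16) p.225; Balaban1987RG1, (0.1) p.251, p.253 («L an odd positive integer»); Balaban1985RegularSpaces, p.77 («values in G ⊂ M_N(ℂ)») (bookkeeping witness)] -/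
def stage3OfRecord₁₂ : Stage3Params where
  ι := Fin 2
  F := OrthFlow.rot
  ℓ₁ := 1
  hℓ₁ := zero_le_one
  hLip := B4Lower18Regular.rot_lipschitz
  D := 4
  L := 3
  hL := ⟨⟨1, rfl⟩, by norm_num⟩
  amin := 1
  aplus := 1
  m2plus := 0
  ha := one_pos
  creg := 0
  β := 1
  a' := 1
  a := 1
  m2 := 0
  C := 0
  a₀ := 0
  p := 1
  d₅ := 4
  N₅ := 2
  𝔸 := Matrix (Fin 2) (Fin 2) ℂ
  instCStar := B10Eq29TubeLine.cstarAlgebraMatrix 2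
  instNontrivial := inferInstance
  d₆ := 3
  ℓ₆ := 2
  hd₆ := rfl
  hℓ₆ := rfl
  b₀ := 1
  b₁ := 1
  hb := ⟨one_pos, le_rfl⟩
  δ₀ := 2 / 3
  hδ₀ := ⟨by positivity, by norm_num⟩

/-- The Stage-1 dictionary of record is admissible (`Stage1Params.Admissible`: every clause a numeral comparison). [cite: Balaban1983RegularityDecay, (1.6) p.572 (bookkeeping)] -/
theorem admissible_stage3OfRecord₁₂ : stage3OfRecord₁₂.toStage1Params.Admissible :=
  ⟨by norm_num [stage3OfRecord₁₂], le_rfl, le_rfl, one_pos, one_pos, one_pos, le_rfl, le_rfl, le_rfl, one_pos, le_rfl, le_rfl, le_rfl⟩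

/-- `D = 4` for the dictionary of record (`rfl`). [cite: Balaban1987RG1, p.253 (bookkeeping)] -/
theorem stage3OfRecord₁₂_D : stage3OfRecord₁₂.D = 4 := rfl

/-- `L = 3` for the dictionary of record (`rfl`). [cite: Balaban1987RG1, p.253 (bookkeeping)] -/
theorem stage3OfRecord₁₂_L : stage3OfRecord₁₂.L = 3 := rfl

variable (F : T4Family) (N : ℕ) [NeZero N]

/-- **The DEGENERATE Stage-5 residual** (as in `Record8Inhabited.exists_admissible_stage8Params_zeroChart`, now a definition): run-constant carriers taken from
the `Node00.Satisfiable` inhabitants, the zero β-functions `zeroHBeta`, `E := 0`, empty domains, zero actions ∕ expansion terms ∕ `χ`, the format predicates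
`False`, `R := id`.  NOT objects of record: every later stage OVERWRITES the fields it reads (`βfun`, `χ`, `dom`, `E`, `R`, the actions, the format slots,
the 𝐑-carrier `V`); the carrier groups `X, Y, Z, W` stay residual free data the record never reads. [cite: Balaban1988Convergent, (0.2) p.244; Balaban1989LargeFieldI, (0.2)–(0.6) pp.176–177 (dictionary of the residual; bookkeeping witness)] -/
def residual5OfRecord₁₂ : Residual₅ F N where
  X := fun _ => Classical.choice nonempty_printedCarriersR
  Y := fun _ => Classical.choice nonempty_printedCarriers9X
  Z := fun _ => Classical.choice nonempty_printedCarriers11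
  V := fun _ => Classical.choice nonempty_printedCarriers14R
  W := fun _ => Classical.choice nonempty_printedCarriers15
  βfun := zeroHBeta
  E := fun _ => 0
  dom := fun _ _ => ∅
  effAction := fun _ _ _ => 0
  wilsonBG := fun _ _ _ => 0
  Ek := fun _ _ _ => 0
  χ := fun _ _ _ => 0
  S218 := fun _ _ _ => False
  ReprA := fun _ _ _ _ _ _ _ => False
  IndA := fun _ _ _ _ _ _ _ => False
  R := fun _ _ => id
  preservesIntegral_R := fun _ _ _ _ => rfl
  integrable_R := fun _ _ _ _ h => h

/-! ## §3. The maker: Stage-8 and Stage-12 parameters from numerics and residual objects -/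

/-- **Stage-8 parameters FROM NUMERICS** `n` and a Stage-5 residual `res`: the dictionary `stage3OfRecord₁₂`, the window `γ := n.γ`, `res`, def-R's numerics
`ν := n.ν`, def-R's trivial representation extraction `trivialRepOfRecord` (unread since Stage 9), `Efl = logz := 0`, the background radius `εbg := n.εbg`, the
CHART OF RECORD of 𝔰𝔲(N) (`Node00/ChartOfRecord`: `Vβ := ℝ^{d(N)}`, `ρ8 := suChartMap N`, `bV :=` the standard basis; `c = 1`) and base histories `v₀ := 0`.
[cite: Balaban1987RG1, (0.21) p.256 and (1.20)–(1.22) p.264; Balaban1988Convergent, (2.4)–(2.5) p.255; Balaban1989LargeFieldI, (0.2) p.176 (parameter dictionary)] -/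
def stage8OfNumerics (n : Stage12Numerics) (res : Residual₅ F N) : Stage8Params F N :=
  { stage3OfRecord₁₂ with
    γ := n.γ
    res := res
    ν := n.ν
    rep := trivialRepOfRecord F N
    Efl := fun _ _ => 0
    logz := fun _ _ => 0
    εbg := n.εbg
    Vβ := Fin (suChartDim N) → ℝ
    ιβ := Fin (suChartDim N)
    ρ8 := suChartMap N
    bV := Pi.basisFun ℝ (Fin (suChartDim N))
    v₀ := fun _ _ => 0 }

/-- The maker's Stage-7 numerics ARE `n.ν` (`rfl`). [cite: Balaban1988Convergent, (2.4) p.255 (bookkeeping)] -/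
theorem stage8OfNumerics_ν (n : Stage12Numerics) (res : Residual₅ F N) : (stage8OfNumerics F N n res).ν = n.ν := rfl

/-- The maker's window constant IS `n.γ` (`rfl`). [cite: Balaban1987RG1, Thm 1 p.255 (bookkeeping)] -/
theorem stage8OfNumerics_γ (n : Stage12Numerics) (res : Residual₅ F N) : (stage8OfNumerics F N n res).γ = n.γ := rfl

/-- The maker's background radius IS `n.εbg` (`rfl`). [cite: Balaban1987RG1, (0.21) p.256 (bookkeeping)] -/
theorem stage8OfNumerics_εbg (n : Stage12Numerics) (res : Residual₅ F N) : (stage8OfNumerics F N n res).εbg = n.εbg := rfl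

/-- **The maker's chart IS a chart of record with `c = 1`** (`Stage8Params.IsChartOfRecord`, by `isSuChart_suChartMap`). [cite: Balaban1987RG1, (1.20)–(1.21) p.264] -/
theorem isChartOfRecord_stage8OfNumerics (n : Stage12Numerics) (res : Residual₅ F N) : (stage8OfNumerics F N n res).IsChartOfRecord 1 :=
  isSuChart_suChartMap N

/-- **STAGE-8 ADMISSIBILITY OF THE MAKER ↔ the Stage-7 windows, `0 < γ` and `0 < εbg`** (Stage-1 admissibility holds by `admissible_stage3OfRecord₁₂`).
[cite: Balaban1987RG1, (0.21) p.256; Balaban1988Convergent, (2.4) p.255, (2.13)–(2.17) pp.256–257 (hypothesis dictionary; bookkeeping)] -/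
theorem admissible_stage8OfNumerics_iff (n : Stage12Numerics) (res : Residual₅ F N) :
    (stage8OfNumerics F N n res).Admissible ↔
      0 < n.γ ∧ (0 < n.ν.ε₀ ∧ 0 < n.ν.εreg ∧ 0 < n.ν.A₀ ∧ 1 ≤ n.ν.M₁ ∧ 1 ≤ n.ν.M₂) ∧ 0 < n.εbg := by
  constructor
  · rintro ⟨⟨⟨-, hγ⟩, hν⟩, hε⟩
    exact ⟨hγ, hν, hε⟩
  · rintro ⟨hγ, hν, hε⟩
    exact ⟨⟨⟨admissible_stage3OfRecord₁₂, hγ⟩, hν⟩, hε⟩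

/-- **Stage-12 parameters FROM NUMERICS `n`, a Stage-5 residual `res`, and the three RESIDUAL OBJECTS `ζ` (Stage 9, (3.16)·(3.20)·(3.21) [III]), `Rz`
(11b's §2 data) and `Zt` (12a's residual 𝐓-weight part)**: over `stage8OfNumerics n res`, def-R's tower numerics `τ9 := n.τ9`, the IDENTITY `p–p′` selector
`ppSelIdOfRecord`, `A₁ := n.A₁`, `ζ`, the «corresponding space» slot `ScorrLaw := ⊤` (superseded at Stage 12 by the pin `ScorrLawOfRecord₁₂`), the chart
constant `cβ := 1`, the §2 numerics `s2 := n.s2`, `Rz`, `Zt`. [cite: Balaban1988Convergent, (2.21) p.258, (3.4) p.265, (3.16) p.268, (3.21) p.269; Balaban1989LargeFieldI, (0.3) p.176, (2.1) p.182; Balaban1987RG1, (1.15) p.262 (parameter dictionary)] -/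
def stage12OfNumerics (n : Stage12Numerics) (res : Residual₅ F N) (ζ : ZetaOfRecord F N n.ν n.τ9.M)
    (Rz : (K : ℕ) → Sect2.Residual (F.P K) (MatA N)) (Zt : (K : ℕ) → TkResidualW F N (FluctV N) K) : Stage12Params F N :=
  { stage8OfNumerics F N n res with
    τ9 := n.τ9
    ppSel := ppSelIdOfRecord F n.ν n.τ9.M
    A₁ := n.A₁
    ζ := ζ
    ScorrLaw := fun _ _ _ => True
    cβ := 1
    s2 := n.s2
    Rz := Rz
    Zt := Zt }

section Views

variable (n : Stage12Numerics) (res : Residual₅ F N) (ζ : ZetaOfRecord F N n.ν n.τ9.M)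
  (Rz : (K : ℕ) → Sect2.Residual (F.P K) (MatA N)) (Zt : (K : ℕ) → TkResidualW F N (FluctV N) K)

/-- The Stage-8 part of the maker IS `stage8OfNumerics n res` (`rfl`). [cite: Balaban1987RG1, (0.21) p.256 (bookkeeping)] -/
theorem stage12OfNumerics_toStage8Params : (stage12OfNumerics F N n res ζ Rz Zt).toStage8Params = stage8OfNumerics F N n res := rfl

/-- The maker's Stage-7 numerics ARE `n.ν` (`rfl`). [cite: Balaban1988Convergent, (2.4) p.255 (bookkeeping)] -/
theorem stage12OfNumerics_ν : (stage12OfNumerics F N n res ζ Rz Zt).ν = n.ν := rfl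

/-- The maker's window constant IS `n.γ` (`rfl`). [cite: Balaban1987RG1, Thm 1 p.255 (bookkeeping)] -/
theorem stage12OfNumerics_γ : (stage12OfNumerics F N n res ζ Rz Zt).γ = n.γ := rfl

/-- The maker's tower numerics ARE `n.τ9` (`rfl`). [cite: Balaban1989LargeFieldI, (2.1) p.182 (bookkeeping)] -/
theorem stage12OfNumerics_τ9 : (stage12OfNumerics F N n res ζ Rz Zt).τ9 = n.τ9 := rfl

/-- The maker's `A₁` IS `n.A₁` (`rfl`). [cite: Balaban1988Convergent, (3.4) p.265 (bookkeeping)] -/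
theorem stage12OfNumerics_A₁ : (stage12OfNumerics F N n res ζ Rz Zt).A₁ = n.A₁ := rfl

/-- The maker's §2 numerics ARE `n.s2` (`rfl`). [cite: Balaban1988Convergent, (2.34)–(2.39) p.261 (bookkeeping)] -/
theorem stage12OfNumerics_s2 : (stage12OfNumerics F N n res ζ Rz Zt).s2 = n.s2 := rfl

/-- The maker's fluctuation factor IS `ζ` (`rfl`). [cite: Balaban1988Convergent, (3.16) p.268 (bookkeeping)] -/
theorem stage12OfNumerics_ζ : (stage12OfNumerics F N n res ζ Rz Zt).ζ = ζ := rfl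

/-- The maker's §2 residual data ARE `Rz` (`rfl`). [cite: Balaban1987RG1, (1.15) p.262 (bookkeeping)] -/
theorem stage12OfNumerics_Rz : (stage12OfNumerics F N n res ζ Rz Zt).Rz = Rz := rfl

/-- The maker's residual 𝐓-weight part IS `Zt` (`rfl`). [cite: Balaban1988Convergent, (2.21) p.258 (bookkeeping)] -/
theorem stage12OfNumerics_Zt : (stage12OfNumerics F N n res ζ Rz Zt).Zt = Zt := rfl

/-- The maker's term constants of record: `n.s2.lf` with the window `γ := n.γ` (`rfl`, def-T's `lfOfRecord₁₂`). [cite: Balaban1988Convergent, (2.27)(iii)–(2.28) p.259 (bookkeeping)] -/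
theorem lfOfRecord₁₂_stage12OfNumerics : lfOfRecord₁₂ F N (stage12OfNumerics F N n res ζ Rz Zt) = { n.s2.lf with γ := n.γ } := rfl

/-- **STAGE-12 ADMISSIBILITY OF THE MAKER ↔ `n.Pos`** — residual-blind: whatever `res`, `ζ`, `Rz`, `Zt`.  (Stage-1 admissibility by `admissible_stage3OfRecord₁₂`,
`0 < cβ = 1`, the chart clause by `isChartOfRecord_stage8OfNumerics`; every other clause is a window of `n`.)
[cite: Balaban1987RG1, (0.21) p.256, (1.12) p.262, (1.20)–(1.21) p.264; Balaban1988Convergent, (2.4) p.255, (2.10) p.256, (2.28) p.259, (2.34)–(2.39) p.261, (3.4) p.265; Balaban1989LargeFieldI, (2.1) p.182 (hypothesis dictionary; bookkeeping)] -/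
theorem admissible_stage12OfNumerics_iff : (stage12OfNumerics F N n res ζ Rz Zt).Admissible F N ↔ n.Pos := by
  constructor
  · rintro ⟨⟨⟨⟨⟨-, hγ⟩, hν⟩, hε⟩, -, -, hM⟩, hs2, hcR, hA₁, hC₀, hC₁, hγ1⟩
    exact ⟨hν, hε, ⟨hγ, hγ1⟩, hM, hA₁, hs2, hcR, hC₀, hC₁⟩
  · rintro ⟨hν, hε, ⟨hγ, hγ1⟩, hM, hA₁, hs2, hcR, hC₀, hC₁⟩
    exact ⟨⟨⟨⟨⟨admissible_stage3OfRecord₁₂, hγ⟩, hν⟩, hε⟩, one_pos, isChartOfRecord_stage8OfNumerics F N n res, hM⟩, hs2, hcR, hA₁, hC₀, hC₁, hγ1⟩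

/-- The maker is admissible at positive numerics. [cite: Balaban1988Convergent, (2.10) p.256, (2.28) p.259, (2.34)–(2.39) p.261 (bookkeeping)] -/
theorem admissible_stage12OfNumerics (h : n.Pos) : (stage12OfNumerics F N n res ζ Rz Zt).Admissible F N :=
  (admissible_stage12OfNumerics_iff F N n res ζ Rz Zt).mpr h

end Views

/-! ## §4. The parameter `θ₀` of record -/

/-- **The Stage-8 part of record**: the maker at the numerics of record and the degenerate Stage-5 residual. [cite: Balaban1987RG1, (0.21) p.256 and (1.20)–(1.22) p.264 (bookkeeping witness)] -/
def stage8OfRecord₁₂ : Stage8Params F N :=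
  stage8OfNumerics F N stage12NumericsOfRecord (residual5OfRecord₁₂ F N)

/-- **THE PARAMETER `θ₀` OF THE STAGE-12 RECORD** at the residual objects `ζ`, `Rz`, `Zt`: the maker at the numerics of record `stage12NumericsOfRecord` and the
degenerate Stage-5 residual — numerics DISPLAYED, residual objects ARGUMENTS (K0b's residuals of record plug in by name).
[cite: Balaban1988Convergent, (2.10) p.256, (2.21) p.258, (2.28) p.259, (3.4) p.265, (3.16) p.268; Balaban1987RG1, (0.21) p.256, (1.12)–(1.16) p.262 (parameter dictionary; bookkeeping witness)] -/
def theta12OfRecord (ζ : ZetaOfRecord F N numerics7OfRecord₁₂ 1) (Rz : (K : ℕ) → Sect2.Residual (F.P K) (MatA N))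
    (Zt : (K : ℕ) → TkResidualW F N (FluctV N) K) : Stage12Params F N :=
  stage12OfNumerics F N stage12NumericsOfRecord (residual5OfRecord₁₂ F N) ζ Rz Zt

section Theta

variable (ζ : ZetaOfRecord F N numerics7OfRecord₁₂ 1) (Rz : (K : ℕ) → Sect2.Residual (F.P K) (MatA N)) (Zt : (K : ℕ) → TkResidualW F N (FluctV N) K)

/-- **`θ₀` IS ADMISSIBLE — for EVERY choice of the residual objects** (rows D1 + A1 + A2 + A3 of the K0′ component table, hypothesis-free).
[cite: Balaban1987RG1, (0.21) p.256, (1.12) p.262, (1.20)–(1.21) p.264; Balaban1988Convergent, (2.10) p.256, (2.28) p.259, (2.34)–(2.39) p.261, (3.4) p.265 (bookkeeping witness)] -/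
theorem admissible_theta12OfRecord : (theta12OfRecord F N ζ Rz Zt).Admissible F N :=
  admissible_stage12OfNumerics F N stage12NumericsOfRecord (residual5OfRecord₁₂ F N) ζ Rz Zt stage12NumericsOfRecord_pos

/-- Row A1: `θ₀`'s Stage-9 part is admissible (Stage-8 windows ∧ `0 < cβ` ∧ the chart clause of record ∧ `1 ≤ M`). [cite: Balaban1987RG1, (1.20)–(1.21) p.264; Balaban1989LargeFieldI, (2.1) p.182 (bookkeeping)] -/
theorem admissible9_theta12OfRecord : (theta12OfRecord F N ζ Rz Zt).toStage9Params.Admissible :=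
  (admissible_theta12OfRecord F N ζ Rz Zt).toStage9

/-- Row A2: `θ₀`'s §2 numerics meet the §2 sign conditions. [cite: Balaban1988Convergent, (2.34)–(2.39) p.261 (bookkeeping)] -/
theorem s2Pos_theta12OfRecord : (theta12OfRecord F N ζ Rz Zt).s2.Pos :=
  (admissible_theta12OfRecord F N ζ Rz Zt).pos

/-- Row A3: `θ₀` meets the Stage-12 signs `Pos₁₂` (`0 < cR`, `0 < A₁`, `0 < C₀`, `0 < C₁`, `γ < 1`). [cite: Balaban1988Convergent, (2.10) p.256, (2.28) p.259, (3.4) p.265 (bookkeeping)] -/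
theorem pos12_theta12OfRecord : (theta12OfRecord F N ζ Rz Zt).Pos₁₂ F N :=
  (admissible_theta12OfRecord F N ζ Rz Zt).pos₁₂

/-- Row P10 AT `θ₀` (def-T's `alphaPos₁₂_of_window`): the radii (2.28) of record are positive in the window `0 < g ≤ 1∕2 = θ₀.γ`.
[cite: Balaban1988Convergent, (2.28) p.259] -/
theorem alphaPos_theta12OfRecord {g : ℝ} (h0 : 0 < g) (hg : g ≤ 1 / 2) :
    0 < (lfOfRecord₁₂ F N (theta12OfRecord F N ζ Rz Zt)).alpha0 g ∧ 0 < (lfOfRecord₁₂ F N (theta12OfRecord F N ζ Rz Zt)).alpha1 g :=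
  alphaPos₁₂_of_window (admissible_theta12OfRecord F N ζ Rz Zt) h0 hg

/-- Row P10 AT `θ₀`, along a generated history in the window (def-T's `alphaPos₁₂_of_inInterval`). [cite: Balaban1988Convergent, (2.28) p.259] -/
theorem alphaPos_theta12OfRecord_of_inInterval {p : B12.RunParams} {m : ℕ}
    (hw : Step.InInterval (theta12OfRecord F N ζ Rz Zt).γ m (gOfRecord₁₀ F N (theta12OfRecord F N ζ Rz Zt).toStage9Params p)) {j : ℕ} (hj : j ≤ m) :
    0 < (lfOfRecord₁₂ F N (theta12OfRecord F N ζ Rz Zt)).alpha0 (gOfRecord₁₀ F N (theta12OfRecord F N ζ Rz Zt).toStage9Params p j) ∧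
      0 < (lfOfRecord₁₂ F N (theta12OfRecord F N ζ Rz Zt)).alpha1 (gOfRecord₁₀ F N (theta12OfRecord F N ζ Rz Zt).toStage9Params p j) :=
  alphaPos₁₂_of_inInterval (admissible_theta12OfRecord F N ζ Rz Zt) hw hj

/-- `θ₀`'s Stage-8 part IS `stage8OfRecord₁₂` (`rfl`). [cite: Balaban1987RG1, (0.21) p.256 (bookkeeping)] -/
theorem theta12OfRecord_toStage8Params : (theta12OfRecord F N ζ Rz Zt).toStage8Params = stage8OfRecord₁₂ F N := rfl

/-- `θ₀`'s Stage-7 numerics (`rfl`). [cite: Balaban1988Convergent, (2.4) p.255 (bookkeeping)] -/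
theorem theta12OfRecord_ν : (theta12OfRecord F N ζ Rz Zt).ν = numerics7OfRecord₁₂ := rfl

/-- `θ₀`'s window constant is `1∕2` (`rfl`). [cite: Balaban1987RG1, Thm 1 p.255 (bookkeeping)] -/
theorem theta12OfRecord_γ : (theta12OfRecord F N ζ Rz Zt).γ = 1 / 2 := rfl

/-- `θ₀`'s cube size `M = 1` (`rfl`). [cite: Balaban1989LargeFieldI, (2.1) p.182 (bookkeeping)] -/
theorem theta12OfRecord_τ9_M : (theta12OfRecord F N ζ Rz Zt).τ9.M = 1 := rfl

/-- `θ₀`'s `A₁ = 1` (`rfl`). [cite: Balaban1988Convergent, (3.4) p.265 (bookkeeping)] -/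
theorem theta12OfRecord_A₁ : (theta12OfRecord F N ζ Rz Zt).A₁ = 1 := rfl

/-- `θ₀`'s §2 numerics (`rfl`). [cite: Balaban1988Convergent, (2.34)–(2.39) p.261 (bookkeeping)] -/
theorem theta12OfRecord_s2 : (theta12OfRecord F N ζ Rz Zt).s2 = sect2NumericsOfRecord₁₂ := rfl

/-- `θ₀`'s term constants of record: the defaults (`lfOfRecord₁₂ θ₀ = lfConstsOfRecord₁₂`, whose `γ` already is `1∕2`; `rfl`). [cite: Balaban1988Convergent, (2.28) p.259 (bookkeeping)] -/
theorem lfOfRecord₁₂_theta12OfRecord : lfOfRecord₁₂ F N (theta12OfRecord F N ζ Rz Zt) = lfConstsOfRecord₁₂ := rfl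

/-- `θ₀`'s fluctuation factor IS `ζ` (`rfl`). [cite: Balaban1988Convergent, (3.16) p.268 (bookkeeping)] -/
theorem theta12OfRecord_ζ : (theta12OfRecord F N ζ Rz Zt).ζ = ζ := rfl

/-- `θ₀`'s `p–p′` selector IS the identity selector (`rfl`). [cite: Balaban1989LargeFieldI, (0.3) p.176 (bookkeeping)] -/
theorem theta12OfRecord_ppSel : (theta12OfRecord F N ζ Rz Zt).ppSel = ppSelIdOfRecord F numerics7OfRecord₁₂ 1 := rfl

/-- `θ₀`'s §2 residual data ARE `Rz` (`rfl`). [cite: Balaban1987RG1, (1.15) p.262 (bookkeeping)] -/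
theorem theta12OfRecord_Rz : (theta12OfRecord F N ζ Rz Zt).Rz = Rz := rfl

/-- `θ₀`'s residual 𝐓-weight part IS `Zt` (`rfl`). [cite: Balaban1988Convergent, (2.21) p.258 (bookkeeping)] -/
theorem theta12OfRecord_Zt : (theta12OfRecord F N ζ Rz Zt).Zt = Zt := rfl

/-- `θ₀`'s chart is a chart of record with `c = 1`. [cite: Balaban1987RG1, (1.20)–(1.21) p.264 (bookkeeping)] -/
theorem isChartOfRecord_theta12OfRecord : (theta12OfRecord F N ζ Rz Zt).toStage8Params.IsChartOfRecord 1 :=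
  isChartOfRecord_stage8OfNumerics F N _ _

end Theta

/-- **BRIDGE TO def-T's RECOMMENDED CARRIER**: at the delta fluctuation factor `zetaDeltaOfRecord` (n23-b), `θ₀`'s Stage-9 part IS
`{stage9DeltaOfRecord (stage8OfRecord₁₂) with A₁ := 1}` (`rfl`) — so n23-b's `Record9∕10ProvisosOfRegularity` reductions, keyed to `stage9DeltaOfRecord`, re-key to `θ₀`
after the one-letter change `A₁ : 0 ↦ 1`. [cite: Balaban1988Convergent, (3.4) p.265, (3.16) p.268 (bookkeeping)] -/
theorem theta12OfRecord_toStage9Params_delta (Rz : (K : ℕ) → Sect2.Residual (F.P K) (MatA N)) (Zt : (K : ℕ) → TkResidualW F N (FluctV N) K) :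
    (theta12OfRecord F N (zetaDeltaOfRecord F N numerics7OfRecord₁₂ 1) Rz Zt).toStage9Params =
      { stage9DeltaOfRecord F N (stage8OfRecord₁₂ F N) with A₁ := 1 } := rfl

/-- **ADMISSIBLE STAGE-12 PARAMETERS EXIST, with 12a's two residual laws** — every four-torus family `F`, every `N ≥ 1`, ANY residual §2 data `Rz` —
with `γ = 1∕2`, `A₁ = 1`, `D = 4`: `θ₀` at the delta fluctuation factor and the unit residual 𝐓-weight part `Zt := ⟨1, 0⟩` (12a's `laws_one`, 12b's
`localLaws_one`).  The shape of def-T's kernel probe PROBE-K0′ (rows A1–A3, P3, P3′ of the K0′ table jointly satisfiable), landed once here; the objects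
OF RECORD for `ζ`, `Rz`, `Zt` are K0b's, these are range witnesses. [cite: Balaban1988Convergent, (2.10) p.256, (2.21) p.258, (2.28) p.259, (2.34)–(2.39) p.261; Balaban1987RG1, (0.21) p.256 (bookkeeping witness)] -/
theorem exists_admissible_stage12Params (Rz : (K : ℕ) → Sect2.Residual (F.P K) (MatA N)) :
    ∃ θ : Stage12Params F N, θ.Admissible F N ∧ (∀ K, (θ.Zt K).Laws) ∧ (∀ K, (θ.Zt K).LocalLaws) ∧ θ.γ = 1 / 2 ∧ θ.A₁ = 1 ∧ θ.D = 4 ∧ θ.Rz = Rz :=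
  ⟨theta12OfRecord F N (zetaDeltaOfRecord F N numerics7OfRecord₁₂ 1) Rz (fun _ => ⟨fun _ _ _ => 1, fun _ _ _ => 0⟩),
    admissible_theta12OfRecord F N _ _ _, fun K => TkResidualW.laws_one K, fun K => TkResidualW.localLaws_one K, rfl, rfl, rfl, rfl⟩

end Literature.MathematicalPhysics.QuantumFieldTheory.Balaban1983to89.Node00

end
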